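import Mathlib.RingTheory.AlgebraicIndependent.Transcendental
import Mathlib.RingTheory.AlgebraicIndependent.Basic
import Mathlib.Algebra.Polynomial.Roots
import Mathlib.Algebra.Polynomial.Cardinal
import Mathlib.Algebra.MvPolynomial.Cardinal
import Mathlib.Data.Fintype.Option
import HarnessLib

/-!
# Algebraically independent lifts along a map with uncountable fibres

Topic `Literature/RingTheory/AlgebraicIndependent`. The counting step in Cassels' embedding theorem
(J. W. S. Cassels, *An embedding theorem for fields*, Bull. Austral. Math. Soc. 14 (1976), proof of
Thm. I: "since `ℤ_p` is uncountable we may choose `ξ₁, …, ξ_m ∈ ℤ_p` algebraically independent over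
`ℚ` with `ξ_j ≡ a_j (mod p)`"; likewise Lang, *Algebra*, Ch. VIII §1, the existence of elements
transcendental over a countable subfield of an uncountable field), isolated in the generality in which
it is a pure counting argument:

* `countable_setOf_isAlgebraic` — over a COUNTABLE ring `S` mapping injectively to an integral domain
  `A`, the elements of `A` algebraic over `S` form a countable set (each non-zero polynomial has
  finitely many roots in a domain, and there are countably many polynomials);
* `exists_algebraicIndependent_lift` — if `π : A → κ` is ANY map all of whose fibres are uncountable,
  `A` an integral domain containing a countable ring `R`, then every finite family `a : ι → κ` lifts
  to an `R`-algebraically independent family `u : ι → A` with `π ∘ u = a` (induction on `ι`: adjoin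
  the lifts found so far — a countable ring — and pick the next lift outside the countable set of
  elements algebraic over it, inside the uncountable fibre; Mathlib
  `AlgebraicIndependent.option_iff_transcendental`).

The intended instance is `A = W(κ)` (or `ℤ_p`), `π` the reduction to the residue ring, `R = ℤ`
(`Literature/RingTheory/CompleteLocalRings/WittVectorEmbedding`).

## References

* [Cassels1976] J. W. S. Cassels, An embedding theorem for fields, Bull. Austral. Math. Soc. 14
  (1976) 193–198, proof of Thm. I.
* [Lang2002] S. Lang, Algebra, GTM 211, Ch. VIII §1 (transcendence bases).
-/

noncomputable section

universe u

open MvPolynomial Cardinal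

namespace Literature.RingTheory.AlgebraicIndependent

section Countable

variable {S A : Type*} [CommRing S] [CommRing A] [Algebra S A]

/-- A polynomial ring over a countable ring is countable (`#S[X] ≤ max #S ℵ₀`, Mathlib
`Polynomial.cardinalMk_le_max`). [folklore] -/
private theorem countable_polynomial [Countable S] : Countable (Polynomial S) := by
  rw [← Cardinal.mk_le_aleph0_iff]
  exact Polynomial.cardinalMk_le_max.trans
    (max_le (Cardinal.mk_le_aleph0_iff.mpr ‹_›) le_rfl)

/-- A polynomial ring in countably many variables over a countable ring is countable (Mathlib
`MvPolynomial.cardinalMk_le_max_lift`). [folklore] -/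
private theorem countable_mvPolynomial {σ : Type*} [Countable σ] [Countable S] :
    Countable (MvPolynomial σ S) := by
  rw [← Cardinal.mk_le_aleph0_iff]
  refine MvPolynomial.cardinalMk_le_max_lift.trans (max_le (max_le ?_ ?_) le_rfl)
  · rw [Cardinal.lift_le_aleph0, Cardinal.mk_le_aleph0_iff]; infer_instance
  · rw [Cardinal.lift_le_aleph0, Cardinal.mk_le_aleph0_iff]; infer_instance

/-- **Over a countable ring, only countably many elements of a domain are algebraic.** If `S` is a
countable ring mapping injectively into an integral domain `A`, the set of elements of `A` algebraic
over `S` is countable: such an element is a root of a non-zero polynomial over `S`, which stays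
non-zero in `A[X]` and so has finitely many roots there, and `S[X]` is countable (Lang, *Algebra*,
VIII §1, the cardinality count behind "a transcendence basis of `ℂ/ℚ` is uncountable"; Cassels 1976,
proof of Thm. I). [cite: Lang2002, Ch. VIII §1] -/
theorem countable_setOf_isAlgebraic [Countable S] [IsDomain A]
    (hinj : Function.Injective (algebraMap S A)) :
    {x : A | IsAlgebraic S x}.Countable := by
  haveI : Countable (Polynomial S) := countable_polynomial
  have hsub : {x : A | IsAlgebraic S x} ⊆ ⋃ p : Polynomial S, p.rootSet A := by
    rintro x ⟨p, hp0, hpx⟩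
    refine Set.mem_iUnion.2 ⟨p, ?_⟩
    rw [Polynomial.mem_rootSet']
    exact ⟨(Polynomial.map_ne_zero_iff hinj).2 hp0, hpx⟩
  exact (Set.countable_iUnion fun p => (p.rootSet_finite A).countable).mono hsub

end Countable

section Lift

variable (R : Type*) {A κ : Type*} [CommRing R] [CommRing A] [Algebra R A]

/-- **Algebraically independent lifts along a map with uncountable fibres** (the counting step of
Cassels' embedding theorem, 1976, proof of Thm. I: in the uncountable ring `ℤ_p` one may choose
lifts `ξ_j ≡ a_j (mod p)` of prescribed residues which are algebraically independent over `ℚ`). Let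
`R` be a countable ring contained in an integral domain `A` (`algebraMap R A` injective) and
`π : A → κ` any map each of whose fibres `π⁻¹(b)` is uncountable. Then every finite family
`a : ι → κ` lifts to a family `u : ι → A`, `π (u i) = a i`, which is algebraically independent over
`R`. Proof: induction on `ι`; having lifted over `ι`, the ring `R[u_i : i ∈ ι]` is countable, so only
countably many elements of `A` are algebraic over it (`countable_setOf_isAlgebraic`), and the
uncountable fibre over the next residue contains an element transcendental over it, which extends the
family (Mathlib `AlgebraicIndependent.option_iff_transcendental`). [cite: Cassels1976, proof of Thm. I] -/
theorem exists_algebraicIndependent_lift [Countable R] [IsDomain A] [FaithfulSMul R A]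
    (π : A → κ) (hπ : ∀ b : κ, ¬ (π ⁻¹' {b}).Countable) (ι : Type u) [Finite ι] (a : ι → κ) :
    ∃ u : ι → A, AlgebraicIndependent R u ∧ ∀ i, π (u i) = a i := by
  revert a
  refine Finite.induction_empty_option
    (P := fun ι => ∀ a : ι → κ, ∃ u : ι → A, AlgebraicIndependent R u ∧ ∀ i, π (u i) = a i)
    ?_ ?_ ?_ ι
  · -- transport along an equivalence of index types
    intro α β e h a
    obtain ⟨u, hu, hua⟩ := h (a ∘ e)
    refine ⟨u ∘ e.symm, (algebraicIndependent_equiv e.symm).2 hu, fun i => ?_⟩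
    simp only [Function.comp_apply, hua, Equiv.apply_symm_apply]
  · -- the empty family
    intro a
    refine ⟨fun i => PEmpty.elim i, ?_, fun i => PEmpty.elim i⟩
    exact (algebraicIndependent_empty_type_iff (R := R)).2 (FaithfulSMul.algebraMap_injective R A)
  · -- the inductive step: one more residue to lift
    intro α _ ih a
    obtain ⟨u, hu, hua⟩ := ih fun i => a (some i)
    set S : Subalgebra R A := Algebra.adjoin R (Set.range u) with hS
    haveI : Countable (MvPolynomial α R) := countable_mvPolynomial
    haveI : Countable S := by
      have hc : (S : Set A).Countable := by
        rw [hS, Algebra.adjoin_range_eq_range_aeval, AlgHom.coe_range]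
        exact Set.countable_range _
      exact hc.to_subtype
    have hT : {x : A | IsAlgebraic S x}.Countable :=
      countable_setOf_isAlgebraic (S := S) (A := A) Subtype.val_injective
    obtain ⟨x, hxa, hxT⟩ : ∃ x : A, π x = a none ∧ ¬ IsAlgebraic S x := by
      by_contra h
      refine hπ (a none) (hT.mono fun x (hx : π x = a none) => ?_)
      by_contra hx'
      exact h ⟨x, hx, hx'⟩
    refine ⟨fun o => o.elim x u, (hu.option_iff_transcendental x).2 hxT, ?_⟩
    rintro (_ | i)
    · exact hxa
    · exact hua i

end Lift

end Literature.RingTheory.AlgebraicIndependent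

end
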